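import Literature.AlgebraicGeometry.HodgeTheory.WeilTypeCMFieldSlotsHodgeClassesOfLie
import Literature.AlgebraicGeometry.HodgeTheory.CMHodgeGroupDualBases
import HarnessLib

/-!
# An imaginary quadratic subfield `K ⊂ E` read on a CM type: the `K`-eigenspace `W_K` is the sum of the blocks of its fibre,
# traces on `W_K` are sums of block traces, and an element of `E` with conjugate-opposite block scalars is Rosati-skew
# (Deligne LNM 900 §4; Moonen–Zarhin 1998 §4, 1999 §1)

Family `hodge`, layer `Literature/AlgebraicGeometry/HodgeTheory` (cell `pub-hodgeav-hg6`, req-37 (A) Q2b, TABLE X ROW 11 =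
`IV(2,1).kE0`, design note `HOME/jobs/ROW11-Esquare-eng4g8/DESIGN.md`, brick R11-6 (dictionary half): the passage between the
`W_K`-trace condition of the cell's displayed Lie hypothesis `hSU` (B5a-E §3, `WeilTypeCMFieldHodgeGroupUEOfLie`) and the block
traces of the CM type). UNCONDITIONAL; theorems only, no definition, no named fact, no `sorry`. HONEST FRAMING of that cell:
HC / HC_AV / HC_CM / H2 NOT proved — linear algebra of polarized weight-one `ℚ`-Hodge structures.

SETTING (eng-5's `CMTheta*` vocabulary): `H` effective polarized of weight `1`, `E = End_Hdg(V) = ℚ[φ]`, CM type `μ : ι → ℂ` with blocks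
`W_{μ k}`, `W_{μ̄ k}` of dimension `n₀` spanning `V_ℂ`; `y ∈ End_ℚ(V)` (think `y = φ_K ∈ K ⊂ E`) whose base change acts by ONE
scalar `ν` on every `W_{μ k}` and by `ν' ≠ ν` on every `W_{μ̄ k}` — «the CM type is the `K`-fibre», the hypotheses `hKE`, `hKE'`
of the cell's B5a-E socket.
* §1 **`CMThetaKWeil.skew_of_apply_eq_neg`** — if `ν' = −ν` then `y` is `ψ`-skew (the Rosati involution is complex conjugation
  on `E`: `ψ_ℂ(W_a, W_b) = 0` unless `b = ā`, `CMTheta.form_eq_zero_of_ne`).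
* §2 **`CMThetaKWeil.trace_restrict_kFibre_eq_sum`** — for `Y` commuting with `φ_ℂ` and `y_ℂ`:
  `tr(Y | ker(y_ℂ − ν)) = Σ_k tr(Y | W_{μ k})` (`ker(y_ℂ − ν)` has the basis of the type-`0` letters of an adapted dual basis,
  `exists_basis_eigenspace_of_blocks`; the matrix of `Y` there is block diagonal, `Matrix.trace_blockDiagonal`).

## References
* [Deligne1982HodgeCycles] P. Deligne, LNM 900 (1982), §4 (p. 30: `H¹ ⊗ ℂ = ⊕_σ H¹_σ`, `ψ` pairs `H¹_σ` with `H¹_σ̄`).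
* [MoonenZarhin1998WeilClasses] B. Moonen, Yu. Zarhin, J. reine angew. Math. 496 (1998), §4 (the spaces `W_F`, `F ⊂ E`).
* [MoonenZarhin1999LowDim] B. Moonen, Yu. Zarhin, Math. Ann. 315 (1999), §1 (the Rosati involution is complex conjugation on `F`).
* [GoodmanWallachGTM255] R. Goodman, N. R. Wallach, GTM 255 (2009), §4.1.1.
-/

noncomputable section

open scoped TensorProduct
open Module

namespace Literature.AlgebraicGeometry.Motives

namespace HodgeStructure

open Literature.AlgebraicGeometry.HodgeTheory (exists_basis_eigenspace_of_blocks toMatrix_restrict_eq_of_apply_eq_sum')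

universe u

variable {V : Type u} [AddCommGroup V] [Module ℚ V] {n : ℤ}

/-- `Fin 2 = {0, 1}`. [folklore] -/
private theorem CMThetaKWeil.fin2_cases' (r : Fin 2) : r = 0 ∨ r = 1 := by
  rcases r with ⟨_ | _ | k, hk⟩
  · exact Or.inl rfl
  · exact Or.inr rfl
  · omega

/-! ### §1 Conjugate-opposite block scalars ⟹ Rosati-skew -/

/-- **An endomorphism acting on `W_{μ k}` by `τ_k` and on `W_{μ̄ k}` by `−τ_k` is `ψ`-skew** (`E = End_Hdg(V) = ℚ[φ]`, CM type `μ`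
spanning `V_ℂ`): `ψ_ℂ` pairs `W_a` only with `W_ā` (`CMTheta.form_eq_zero_of_ne`), where the two scalars cancel; e.g. `y = φ_K`
generating an imaginary quadratic `K ⊂ E` (`τ ≡ i√d`). Mumford §21 / Moonen–Zarhin §1: the Rosati involution is complex
conjugation on a CM field. [cite: MoonenZarhin1999LowDim, §1] [cite: Deligne1982HodgeCycles, §4 (p. 30)] -/
theorem CMThetaKWeil.skew_of_apply_eq_neg [Module.Finite ℚ V] [HodgeTensorFacts.{u, u}] {ι : Type} [Fintype ι]
    [DecidableEq ι] (H : HodgeStructure V n) (hn : n = 1) (heff : H.IsEffective) (ψ : H.Polarization)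
    {φ : Module.End ℚ V} (hφE : φ ∈ H.endAlg) {m : ℕ} (hE : ∀ a ∈ H.endAlg, ∃ q : Fin m → ℚ, a = ∑ k, q k • φ ^ (k : ℕ))
    (μ : ι → ℂ) (hinj : Function.Injective μ) (hdist : ∀ k k', μ k' ≠ starRingEnd ℂ (μ k))
    (htop : (⨆ kt : ι × Fin 2, Module.End.eigenspace (φ.baseChange ℂ)
      (if kt.2 = 0 then μ kt.1 else starRingEnd ℂ (μ kt.1))) = ⊤)
    {y : Module.End ℚ V} (τ : ι → ℂ) (hy0 : ∀ k, ∀ w ∈ Module.End.eigenspace (φ.baseChange ℂ) (μ k), y.baseChange ℂ w = τ k • w)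
    (hy1 : ∀ k, ∀ w ∈ Module.End.eigenspace (φ.baseChange ℂ) (starRingEnd ℂ (μ k)), y.baseChange ℂ w = -(τ k • w)) :
    ∀ v w, ψ.form (y v) w + ψ.form v (y w) = 0 := by
  classical
  set F := φ.baseChange ℂ with hF
  set ψC := ψ.form.baseChange ℂ with hψC
  set ev : ι × Fin 2 → ℂ := fun kt => if kt.2 = 0 then μ kt.1 else starRingEnd ℂ (μ kt.1) with hevdef
  have hev0 : ∀ k, ev (k, 0) = μ k := fun k => by simp [hevdef]
  have hev1 : ∀ k, ev (k, 1) = starRingEnd ℂ (μ k) := fun k => by simp [hevdef]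
  -- the scalar of `y_ℂ` on the block `kt`, and its sign rule
  set σ : ι × Fin 2 → ℂ := fun kt => if kt.2 = 0 then τ kt.1 else -τ kt.1 with hσdef
  have hyσ : ∀ kt, ∀ w ∈ Module.End.eigenspace F (ev kt), y.baseChange ℂ w = σ kt • w := by
    rintro ⟨k, t⟩ w hw
    rcases CMThetaKWeil.fin2_cases' t with rfl | rfl
    · rw [hev0] at hw; simp only [hσdef, if_pos]; exact hy0 k w hw
    · rw [hev1] at hw; simp only [hσdef, if_neg one_ne_zero, neg_smul]; exact hy1 k w hw
  have horth : ∀ {a b : ℂ}, a ≠ starRingEnd ℂ b → ∀ {x z : ℂ ⊗[ℚ] V},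
      x ∈ Module.End.eigenspace F a → z ∈ Module.End.eigenspace F b → ψC x z = 0 :=
    fun hab _ _ hx hz => CMTheta.form_eq_zero_of_ne H hn heff ψ hφE hE hab hx hz
  -- blockwise: either the blocks are not conjugate (both pairings vanish) or the scalars cancel
  have hblock : ∀ kt kt', ∀ x ∈ Module.End.eigenspace F (ev kt), ∀ z ∈ Module.End.eigenspace F (ev kt'),
      ψC (y.baseChange ℂ x) z + ψC x (y.baseChange ℂ z) = 0 := by
    rintro ⟨k, t⟩ ⟨k', t'⟩ x hx z hz
    rw [hyσ _ x hx, hyσ _ z hz, map_smul, LinearMap.smul_apply, map_smul, smul_eq_mul, smul_eq_mul, ← add_mul]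
    by_cases hconj : ev (k, t) = starRingEnd ℂ (ev (k', t'))
    · -- conjugate blocks: `k = k'`, `t ≠ t'`, scalars `τ k`, `−τ k`
      have hkt : k = k' ∧ t ≠ t' := by
        rcases CMThetaKWeil.fin2_cases' t with rfl | rfl <;> rcases CMThetaKWeil.fin2_cases' t' with rfl | rfl
        · rw [hev0, hev0] at hconj; exact absurd hconj (hdist k' k)
        · rw [hev0, hev1, starRingEnd_self_apply] at hconj; exact ⟨hinj hconj, by decide⟩
        · rw [hev1, hev0] at hconj; exact ⟨hinj ((starRingEnd ℂ).injective hconj), by decide⟩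
        · rw [hev1, hev1, starRingEnd_self_apply] at hconj; exact absurd hconj.symm (hdist k k')
      obtain ⟨rfl, htt'⟩ := hkt
      have hsum : σ (k, t) + σ (k, t') = 0 := by
        rcases CMThetaKWeil.fin2_cases' t with rfl | rfl <;> rcases CMThetaKWeil.fin2_cases' t' with rfl | rfl
        · exact absurd rfl htt'
        · simp [hσdef]
        · simp [hσdef]
        · exact absurd rfl htt'
      rw [hsum, zero_mul]
    · rw [horth hconj hx hz, mul_zero]
  -- on all of `V_ℂ`, by the span of the blocks
  have hall : ∀ x z : ℂ ⊗[ℚ] V, ψC (y.baseChange ℂ x) z + ψC x (y.baseChange ℂ z) = 0 := by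
    intro x z
    have hx : x ∈ ⨆ kt, Module.End.eigenspace F (ev kt) := by rw [htop]; exact Submodule.mem_top
    have hz : z ∈ ⨆ kt, Module.End.eigenspace F (ev kt) := by rw [htop]; exact Submodule.mem_top
    refine Submodule.iSup_induction _ hx (motive := fun x => ψC (y.baseChange ℂ x) z + ψC x (y.baseChange ℂ z) = 0) ?_
      (by simp only [map_zero, LinearMap.zero_apply, zero_add]) (fun x x' hx hx' => by
        simp only [map_add, LinearMap.add_apply]; linear_combination hx + hx')
    intro kt x hx
    refine Submodule.iSup_induction _ hz (motive := fun z => ψC (y.baseChange ℂ x) z + ψC x (y.baseChange ℂ z) = 0) ?_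
      (by simp only [map_zero, add_zero]) (fun z z' hz hz' => by simp only [map_add]; linear_combination hz + hz')
    intro kt' z hz
    exact hblock kt kt' x hx z hz
  -- descend to `V`
  intro v w
  have h := hall ((1 : ℂ) ⊗ₜ[ℚ] v) ((1 : ℂ) ⊗ₜ[ℚ] w)
  rw [LinearMap.baseChange_tmul, LinearMap.baseChange_tmul, hψC, LinearMap.BilinForm.baseChange_tmul,
    LinearMap.BilinForm.baseChange_tmul, mul_one, ← add_smul, smul_eq_zero] at h
  exact h.resolve_right one_ne_zero

/-! ### §2 Traces on the `K`-eigenspace are sums of block traces -/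

/-- **`tr(Y | W_K) = Σ_k tr(Y | W_{μ k})`** when the CM type is the `K`-fibre: `y_ℂ` acts by `ν` on every `W_{μ k}` and by
`ν' ≠ ν` on every `W_{μ̄ k}`, so `W_K := ker(y_ℂ − ν)` has as basis the type-`0` letters of an adapted dual basis
(`exists_basis_eigenspace_of_blocks`), in which an operator `Y` commuting with `φ_ℂ` (and with `y_ℂ`) is block diagonal with
the blocks `Y|_{W_{μ k}}` (`Matrix.trace_blockDiagonal`). [cite: MoonenZarhin1998WeilClasses, §4] [cite: Deligne1982HodgeCycles, §4 (p. 30)]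
[cite: GoodmanWallachGTM255, §4.1.1] -/
theorem CMThetaKWeil.trace_restrict_kFibre_eq_sum [Module.Finite ℚ V] [HodgeTensorFacts.{u, u}] {ι : Type} [Fintype ι]
    [DecidableEq ι] (H : HodgeStructure V n) (hn : n = 1) (heff : H.IsEffective) (ψ : H.Polarization)
    {φ : Module.End ℚ V} (hφE : φ ∈ H.endAlg) {m : ℕ} (hE : ∀ a ∈ H.endAlg, ∃ q : Fin m → ℚ, a = ∑ k, q k • φ ^ (k : ℕ))
    (μ : ι → ℂ) (hinj : Function.Injective μ) (hdist : ∀ k k', μ k' ≠ starRingEnd ℂ (μ k)) {n₀ : ℕ}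
    (hrank : ∀ k, Module.finrank ℂ ↥(Module.End.eigenspace (φ.baseChange ℂ) (μ k) ⊓ H.piece 1 0) +
      Module.finrank ℂ ↥(Module.End.eigenspace (φ.baseChange ℂ) (μ k) ⊓ H.piece 0 1) = n₀)
    (htop : (⨆ kt : ι × Fin 2, Module.End.eigenspace (φ.baseChange ℂ)
      (if kt.2 = 0 then μ kt.1 else starRingEnd ℂ (μ kt.1))) = ⊤)
    {y : Module.End ℚ V} {ν ν' : ℂ} (hνν' : ν' ≠ ν)
    (hK : ∀ k, Module.End.eigenspace (φ.baseChange ℂ) (μ k) ≤ Module.End.eigenspace (y.baseChange ℂ) ν)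
    (hK' : ∀ k, Module.End.eigenspace (φ.baseChange ℂ) (starRingEnd ℂ (μ k)) ≤ Module.End.eigenspace (y.baseChange ℂ) ν')
    {Y : Module.End ℂ (ℂ ⊗[ℚ] V)} (hYφ : Y * φ.baseChange ℂ = φ.baseChange ℂ * Y)
    (hYy : Y * y.baseChange ℂ = y.baseChange ℂ * Y) :
    LinearMap.trace ℂ _ (Y.restrict fun x (hx : x ∈ Module.End.eigenspace (y.baseChange ℂ) ν) =>
        UnitaryTheta.apply_mem_eigenspace_of_commute hYy hx) =
      ∑ k, LinearMap.trace ℂ _ (Y.restrict fun x (hx : x ∈ Module.End.eigenspace (φ.baseChange ℂ) (μ k)) =>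
        UnitaryTheta.apply_mem_eigenspace_of_commute hYφ hx) := by
  classical
  set F := φ.baseChange ℂ with hF
  obtain ⟨cb, κ, hcbW, hcbW', -, -, -, -⟩ := CMTheta.exists_adaptedDualBasis H hn heff ψ hφE hE μ hinj hdist hrank htop
  have hYW : ∀ k, ∀ w ∈ Module.End.eigenspace F (μ k), Y w ∈ Module.End.eigenspace F (μ k) := fun k w hw =>
    UnitaryTheta.apply_mem_eigenspace_of_commute hYφ hw
  have hYK : ∀ w ∈ Module.End.eigenspace (y.baseChange ℂ) ν, Y w ∈ Module.End.eigenspace (y.baseChange ℂ) ν := fun w hw =>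
    UnitaryTheta.apply_mem_eigenspace_of_commute hYy hw
  -- eigenvalues of `φ_ℂ` and of `y_ℂ` on the letters
  set ev : ι × Fin 2 → ℂ := fun kt => if kt.2 = 0 then μ kt.1 else starRingEnd ℂ (μ kt.1) with hevdef
  have hev0 : ∀ k, ev (k, 0) = μ k := fun k => by simp [hevdef]
  have hev1 : ∀ k, ev (k, 1) = starRingEnd ℂ (μ k) := fun k => by simp [hevdef]
  have hev : Function.Injective ev := by
    rintro ⟨k, t⟩ ⟨k', t'⟩ h
    rcases CMThetaKWeil.fin2_cases' t with rfl | rfl <;> rcases CMThetaKWeil.fin2_cases' t' with rfl | rfl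
    · rw [hev0, hev0] at h; rw [hinj h]
    · rw [hev0, hev1] at h; exact absurd h (hdist k' k)
    · rw [hev1, hev0] at h; exact absurd h.symm (hdist k k')
    · rw [hev1, hev1] at h; rw [hinj ((starRingEnd ℂ).injective h)]
  have hcbev : ∀ kt ℓ, cb (kt, ℓ) ∈ Module.End.eigenspace F (ev kt) := by
    rintro ⟨k, t⟩ ℓ
    rcases CMThetaKWeil.fin2_cases' t with rfl | rfl
    · rw [hev0]; exact hcbW k ℓ
    · rw [hev1]; exact hcbW' k ℓ
  have hφcb : ∀ kt ℓ, F (cb (kt, ℓ)) = ev kt • cb (kt, ℓ) := fun kt ℓ => Module.End.mem_eigenspace_iff.1 (hcbev kt ℓ)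
  set evK : Fin 2 → ℂ := ![ν, ν'] with hevKdef
  have hycb : ∀ (t : Fin 2) (r : Fin n₀) (k : ι), y.baseChange ℂ (cb ((k, t), r)) = evK t • cb ((k, t), r) := by
    intro t r k
    rcases CMThetaKWeil.fin2_cases' t with rfl | rfl
    · exact Module.End.mem_eigenspace_iff.1 (hK k (hcbW k r))
    · exact Module.End.mem_eigenspace_iff.1 (hK' k (hcbW' k r))
  -- bases: of each block `W_{μ k}` (the letters `cb ((k,0), ·)`) and of `W_K` (all type-`0` letters)
  have hbk : ∀ k, ∃ bk : Module.Basis (Fin n₀) ℂ ↥(Module.End.eigenspace F (μ k)), ∀ ℓ, (bk ℓ : ℂ ⊗[ℚ] V) = cb ((k, 0), ℓ) := by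
    intro k
    obtain ⟨bk, hbk⟩ := exists_basis_eigenspace_of_blocks cb (f := F) (ε := ev) hφcb (k, 0) (μ := μ k) (hev0 k)
      (fun kt hkt h => hkt (hev (h.trans (hev0 k).symm)))
    exact ⟨bk, hbk⟩
  choose bk hbk using hbk
  set eW : Fin 2 × (Fin n₀ × ι) ≃ (ι × Fin 2) × Fin n₀ :=
    { toFun := fun x => ((x.2.2, x.1), x.2.1)
      invFun := fun z => (z.1.2, (z.2, z.1.1))
      left_inv := fun x => rfl
      right_inv := fun z => rfl } with heW
  set cbW : Module.Basis (Fin 2 × (Fin n₀ × ι)) ℂ (ℂ ⊗[ℚ] V) := cb.reindex eW.symm with hcbWdef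
  have hcbW_apply : ∀ (t : Fin 2) (r : Fin n₀) (k : ι), cbW (t, (r, k)) = cb ((k, t), r) := fun t r k => by
    rw [hcbWdef, Module.Basis.reindex_apply, Equiv.symm_symm]
    rfl
  obtain ⟨bW, hbW⟩ := exists_basis_eigenspace_of_blocks cbW (f := y.baseChange ℂ) (ε := evK)
    (fun t rk => by obtain ⟨r, k⟩ := rk; rw [hcbW_apply]; exact hycb t r k) 0 (μ := ν) (by simp [hevKdef])
    (fun t ht => by
      rcases CMThetaKWeil.fin2_cases' t with rfl | rfl
      · exact absurd rfl ht
      · simpa [hevKdef] using hνν')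
  have hbW' : ∀ rk : Fin n₀ × ι, (bW rk : ℂ ⊗[ℚ] V) = cb ((rk.2, 0), rk.1) := fun rk => by rw [hbW, hcbW_apply]
  -- the blocks `M k` of `Y`
  set M : ι → Matrix (Fin n₀) (Fin n₀) ℂ := fun k => LinearMap.toMatrix (bk k) (bk k) (Y.restrict (hYW k)) with hMdef
  have hYcb : ∀ k ℓ, Y (cb ((k, 0), ℓ)) = ∑ r, M k r ℓ • cb ((k, 0), r) := by
    intro k ℓ
    have h : Y.restrict (hYW k) (bk k ℓ) = ∑ r, M k r ℓ • bk k r := by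
      have h0 := Matrix.toLin_self (v₁ := bk k) (v₂ := bk k) (M k) ℓ
      rw [hMdef, Matrix.toLin_toMatrix] at h0
      exact h0
    have h' := congrArg Subtype.val h
    rw [LinearMap.coe_restrict_apply, hbk, Submodule.coe_sum] at h'
    rw [h']
    exact Finset.sum_congr rfl fun r _ => by rw [Submodule.coe_smul, hbk]
  have htrk : ∀ k, LinearMap.trace ℂ _ (Y.restrict (hYW k)) = (M k).trace := fun k => by
    rw [hMdef, LinearMap.trace_eq_matrix_trace ℂ (bk k)]
  -- `Y` on the basis of `W_K` is block diagonal
  have hYbW : ∀ rk : Fin n₀ × ι, Y (cb ((rk.2, 0), rk.1)) = ∑ x : Fin n₀ × ι, Matrix.blockDiagonal M x rk • cb ((x.2, 0), x.1) := by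
    rintro ⟨ℓ, k⟩
    rw [hYcb, Fintype.sum_prod_type_right, Finset.sum_eq_single k]
    · exact Finset.sum_congr rfl fun r _ => by rw [Matrix.blockDiagonal_apply_eq]
    · intro k' _ hk'
      exact Finset.sum_eq_zero fun r _ => by rw [Matrix.blockDiagonal_apply_ne _ _ _ hk', zero_smul]
    · intro hk; exact absurd (Finset.mem_univ k) hk
  have hmat := toMatrix_restrict_eq_of_apply_eq_sum' bW hbW' hYK (Matrix.blockDiagonal M) hYbW
  rw [LinearMap.trace_eq_matrix_trace ℂ bW, hmat, Matrix.trace_blockDiagonal]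
  exact Finset.sum_congr rfl fun k _ => (htrk k).symm

end HodgeStructure

end Literature.AlgebraicGeometry.Motives

end
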